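import Summits.MatrixMultiplication.MatrixMultiplication.Theorems.AbelianSTPPCensusShapeCertVPSemantics
import Summits.MatrixMultiplication.MatrixMultiplication.Theorems.AbelianSTPPCensusShapeCertUniverse

/-!
# Abelian STPP census — soundness of `ShapeCertVP` (part 2: the static data is correct)

Cell mm-stpp, route `AbelianSTPPCensusVP`, crux `ShapeExclusionVP337` (stmt-MatrixMultiplication-19191); seat mm-stpp-theory.
Kernel evaluations (`decide +kernel`, no `native_decide`) over the universe of order 337 in six slices certify the data
file `…VPData` / `…VPCand`, and the consequences used by the search are derived:
* `gainV_pow_le` — `V⁵·10³⁶ ≤ gainV(V)⁶` for `V ≤ 337` (so `V^{5/6} ≤ gainV(V)/10⁶`);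
* `rhoT_le_tabR` / `qhT_le_tabG` — for a universe shape `x` of any order `M ≤ 337` with ratio level `≤ L`, the tables
  at level `L` dominate its packing ratio (in every admitting volume bucket) and its six Grynkiewicz ratios
  (slice checks `allOK_s*` + monotonicity of the tables in the level + monotonicity of the universe in the order);
* `shV_mem_candV` — every universe shape of order `M ≤ 337` and level `≥ 28` is a candidate of `candV M`;
  `candV_wf`, `candV_inUniv`, `candV_sorted` — the candidates are well-formed records inside the universe, in
  non-increasing level order.
-/

set_option linter.dupNamespace false -- `MatrixMultiplication.MatrixMultiplication` (summit = problem, D-0017)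
set_option autoImplicit false

namespace Summit.MatrixMultiplication.MatrixMultiplication.Theorems.ShapeCertVP

open ShapeCert

section kernel_checks
/-! ### Kernel evaluations -/

/-- the gain table inequality `V⁵ · 10³⁶ ≤ gainV(V)⁶` for `V ≤ 337` -/
theorem gainV_pow_le : ∀ V ≤ 337, V ^ 5 * 1000000 ^ 6 ≤ gainV V ^ 6 := by decide +kernel

/-- data checks, universe slice `a = 1` -/
theorem allOK_s0 : ((univ0S 337 0 1).all allOK) = true := by decide +kernel
/-- data checks, universe slice `a = 2` -/
theorem allOK_s1 : ((univ0S 337 1 1).all allOK) = true := by decide +kernel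
/-- data checks, universe slice `a ∈ {3, 4}` -/
theorem allOK_s2 : ((univ0S 337 2 2).all allOK) = true := by decide +kernel
/-- data checks, universe slice `5 ≤ a ≤ 8` -/
theorem allOK_s3 : ((univ0S 337 4 4).all allOK) = true := by decide +kernel
/-- data checks, universe slice `9 ≤ a ≤ 20` -/
theorem allOK_s4 : ((univ0S 337 8 12).all allOK) = true := by decide +kernel
/-- data checks, universe slice `21 ≤ a ≤ 337` -/
theorem allOK_s5 : ((univ0S 337 20 317).all allOK) = true := by decide +kernel

/-- the ratio table is non-decreasing in the level (checked range) -/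
theorem tabR_step_dec : ∀ L < 60, ∀ k < 8, (tabR L).get k ≤ (tabR (L + 1)).get k := by decide +kernel
/-- the Grynkiewicz table is non-decreasing in the level (checked range) -/
theorem tabG_step_dec : ∀ L < 60, ∀ i < 6, (tabG L).get i ≤ (tabG (L + 1)).get i := by decide +kernel
/-- every tabled triple sits at its own ratio level -/
theorem litLev_lev : ∀ L < 64, ∀ x ∈ litLev L, levT x = L := by decide +kernel
/-- the candidate triples come in non-increasing ratio level -/
theorem candTriples_chain : (candTriples.map levT).IsChain (fun a b => b ≤ a) := by decide +kernel

end kernel_checks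

section tables
/-! ### Monotonicity of the tables -/

/-- components beyond `5` read the last -/
theorem G6.get_ge5 (G : G6) {i : ℕ} (hi : 5 ≤ i) : G.get i = G.g5 := by
  obtain ⟨j, rfl⟩ := Nat.exists_eq_add_of_le hi
  rw [Nat.add_comm]; rfl

/-- high levels read the top row -/
theorem tabR_high {L : ℕ} (h : 55 ≤ L) : tabR L = tabR 55 := by
  unfold tabR
  rw [if_neg (by omega), if_neg (by omega), if_neg (by omega), if_neg (by omega),
    List.getD_eq_default _ _ (by simp [tabRL3]; omega), List.getD_eq_default _ _ (by simp [tabRL3])]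

/-- high levels read the top row -/
theorem tabG_high {L : ℕ} (h : 55 ≤ L) : tabG L = tabG 55 := by
  unfold tabG
  rw [if_neg (by omega), if_neg (by omega), if_neg (by omega), if_neg (by omega),
    List.getD_eq_default _ _ (by simp [tabGL3]; omega), List.getD_eq_default _ _ (by simp [tabGL3])]

/-- one level step of the ratio table -/
theorem tabR_step (L k : ℕ) : (tabR L).get k ≤ (tabR (L + 1)).get k := by
  have hk : (tabR L).get k = (tabR L).get (min k 7) ∧ (tabR (L + 1)).get k = (tabR (L + 1)).get (min k 7) := by
    rcases Nat.lt_or_ge k 7 with h | h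
    · rw [min_eq_left h.le]; exact ⟨rfl, rfl⟩
    · rw [min_eq_right h]; obtain ⟨j, rfl⟩ := Nat.exists_eq_add_of_le h; rw [Nat.add_comm]; exact ⟨rfl, rfl⟩
  rw [hk.1, hk.2]
  rcases Nat.lt_or_ge L 60 with hL | hL
  · exact tabR_step_dec L hL _ (by omega)
  · rw [tabR_high (by omega : 55 ≤ L), tabR_high (by omega : 55 ≤ L + 1)]

/-- one level step of the Grynkiewicz table -/
theorem tabG_step (L i : ℕ) : (tabG L).get i ≤ (tabG (L + 1)).get i := by
  have hi : (tabG L).get i = (tabG L).get (min i 5) ∧ (tabG (L + 1)).get i = (tabG (L + 1)).get (min i 5) := by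
    rcases Nat.lt_or_ge i 5 with h | h
    · rw [min_eq_left h.le]; exact ⟨rfl, rfl⟩
    · rw [min_eq_right h]; obtain ⟨j, rfl⟩ := Nat.exists_eq_add_of_le h; rw [Nat.add_comm]; exact ⟨rfl, rfl⟩
  rw [hi.1, hi.2]
  rcases Nat.lt_or_ge L 60 with hL | hL
  · exact tabG_step_dec L hL _ (by omega)
  · rw [tabG_high (by omega : 55 ≤ L), tabG_high (by omega : 55 ≤ L + 1)]

/-- **the ratio table is non-decreasing in the level** -/
theorem tabR_mono {L L' : ℕ} (h : L ≤ L') (k : ℕ) : (tabR L).get k ≤ (tabR L').get k := by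
  induction h with
  | refl => exact le_rfl
  | step _ ih => exact ih.trans (tabR_step _ k)

/-- **the Grynkiewicz table is non-decreasing in the level** -/
theorem tabG_mono {L L' : ℕ} (h : L ≤ L') (i : ℕ) : (tabG L).get i ≤ (tabG L').get i := by
  induction h with
  | refl => exact le_rfl
  | step _ ih => exact ih.trans (tabG_step _ i)

end tables

section universe_slices
/-! ### The universe slices: well-formed, inside `InUniv`, complete -/

variable {M : ℕ}

/-- `InUniv` is monotone in the order -/
theorem inUniv_mono {M' : ℕ} {x : ℕ × ℕ × ℕ} (h : InUniv M x) (hM : M ≤ M') : InUniv M' x := by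
  unfold InUniv inUnivB at *
  simp only [Bool.and_eq_true, decide_eq_true_eq] at *
  obtain ⟨⟨⟨⟨⟨⟨h1, h2⟩, h3⟩, h4⟩, h5⟩, h6⟩, h7⟩ := h
  exact ⟨⟨⟨⟨⟨⟨h1, h2⟩, h3⟩, h4.trans hM⟩, h5.trans hM⟩, h6.trans hM⟩, h7.trans hM⟩

/-- members of a slice are well formed and inside `InUniv` -/
theorem mem_univ0S {lo n : ℕ} {t : Sh} (ht : t ∈ univ0S M lo n) : t = shV M t.tr ∧ InUniv M t.tr := by
  unfold univ0S at ht
  simp only [List.mem_flatMap, List.mem_filterMap, List.mem_range, List.mem_range'_1, Sh.force_eq,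
    Option.ite_none_right_eq_some, Option.some.injEq] at ht
  obtain ⟨a', -, b', -, c', -, hin, rfl⟩ := ht
  exact ⟨rfl, hin⟩

/-- **completeness of a slice** (after `ShapeCert.shOf_mem_univ0`) -/
theorem shV_mem_univ0S {lo n : ℕ} {x : ℕ × ℕ × ℕ} (hx : InUniv M x) (h1 : lo ≤ x.1 - 1) (h2 : x.1 - 1 < lo + n) :
    shV M x ∈ univ0S M lo n := by
  obtain ⟨ha, hb, hc⟩ := hx.pos
  have hv := hx.vol_le
  have hab : x.2.1 * x.1 ≤ M := by
    have h1 := hx.pab_le_vol; unfold pab vol at *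
    have : x.1 * x.2.1 * x.2.2 ≤ M := le_trans (Nat.le_add_right _ _) hv
    nlinarith
  have habc : x.2.2 * (x.1 * x.2.1) ≤ M := by
    unfold vol at hv
    have e : x.2.2 * (x.1 * x.2.1) = x.1 * x.2.1 * x.2.2 := by ring
    have := Nat.le_add_right (x.1 * x.2.1 * x.2.2) (max x.1 (max x.2.1 x.2.2))
    rw [e]; exact this.trans hv
  unfold univ0S
  simp only [List.mem_flatMap, List.mem_filterMap, List.mem_range, List.mem_range'_1, Sh.force_eq,
    Option.ite_none_right_eq_some, Option.some.injEq]
  refine ⟨x.1 - 1, ⟨h1, by omega⟩, x.2.1 - 1, ?_, x.2.2 - 1, ?_, ?_, ?_⟩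
  · rw [Nat.sub_add_cancel ha]
    exact Nat.lt_of_lt_of_le (Nat.sub_lt hb one_pos) ((Nat.le_div_iff_mul_le ha).mpr hab)
  · rw [Nat.sub_add_cancel ha, Nat.sub_add_cancel hb]
    exact Nat.lt_of_lt_of_le (Nat.sub_lt hc one_pos) ((Nat.le_div_iff_mul_le (Nat.mul_pos ha hb)).mpr habc)
  · rw [Nat.sub_add_cancel ha, Nat.sub_add_cancel hb, Nat.sub_add_cancel hc]; exact hx
  · rw [Nat.sub_add_cancel ha, Nat.sub_add_cancel hb, Nat.sub_add_cancel hc]; rfl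

/-- **the data checks hold for every universe shape of order 337** (the six slices cover `1 ≤ a ≤ 337`) -/
theorem allOK_of_inUniv {x : ℕ × ℕ × ℕ} (hx : InUniv 337 x) : allOK (shV 337 x) = true := by
  have ha := hx.a_le
  obtain ⟨ha1, -, -⟩ := hx.pos
  have pick : ∀ {lo n : ℕ}, ((univ0S 337 lo n).all allOK) = true → lo ≤ x.1 - 1 → x.1 - 1 < lo + n →
      allOK (shV 337 x) = true :=
    fun h h1 h2 => List.all_eq_true.mp h _ (shV_mem_univ0S hx h1 h2)
  rcases Nat.lt_or_ge (x.1 - 1) 1 with h | h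
  · exact pick allOK_s0 (Nat.zero_le _) (by omega)
  rcases Nat.lt_or_ge (x.1 - 1) 2 with h' | h'
  · exact pick allOK_s1 h (by omega)
  rcases Nat.lt_or_ge (x.1 - 1) 4 with h'' | h''
  · exact pick allOK_s2 h' (by omega)
  rcases Nat.lt_or_ge (x.1 - 1) 8 with h3 | h3
  · exact pick allOK_s3 h'' (by omega)
  rcases Nat.lt_or_ge (x.1 - 1) 20 with h4 | h4
  · exact pick allOK_s4 h3 (by omega)
  · exact pick allOK_s5 h4 (by omega)

end universe_slices

section consequences
/-! ### What the search uses -/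

variable {M : ℕ} {x : ℕ × ℕ × ℕ}

/-- **the ratio table dominates**: a universe shape of order `M ≤ 337` with level `≤ L` has `rho ≤ tabR L k` in every
volume bucket `k` admitting it -/
theorem rhoT_le_tabR (hM : M ≤ 337) (hx : InUniv M x) {L : ℕ} (hL : levT x ≤ L) {k : ℕ}
    (hk : capOK k (vol x) = true) : rhoT x ≤ (tabR L).get k := by
  have h := allOK_of_inUniv (inUniv_mono hx hM)
  unfold allOK tabOK at h
  simp only [Bool.and_eq_true, List.all_eq_true, List.mem_range, Bool.or_eq_true, Bool.not_eq_true',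
    decide_eq_true_eq, shV_V, shV_rho, shV_lev] at h
  have hk7 : capOK (min k 7) (vol x) = true := by rwa [capOK_min7]
  have h1 : rhoT x ≤ (tabR (levT x)).get (min k 7) := by
    rcases h.1.1 (min k 7) (by omega) with h' | h'
    · rw [h'] at hk7; exact absurd hk7 (by decide)
    · exact h'
  have h2 : (tabR L).get k = (tabR L).get (min k 7) := by
    rcases Nat.lt_or_ge k 7 with h | h
    · rw [min_eq_left h.le]
    · rw [min_eq_right h, B8.get_ge7 _ h, B8.get_ge7 _ (le_refl 7)]
  rw [h2]; exact h1.trans (tabR_mono hL _)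

/-- **the Grynkiewicz table dominates**: a universe shape of order `M ≤ 337` with level `≤ L` has `qh_t ≤ tabG L i`
for each of the six parameters `t = tOf i` -/
theorem qhT_le_tabG (hM : M ≤ 337) (hx : InUniv M x) {L : ℕ} (hL : levT x ≤ L) (i : ℕ) :
    qhT x (tOf i) ≤ (tabG L).get i := by
  have h := allOK_of_inUniv (inUniv_mono hx hM)
  unfold allOK tabOK at h
  simp only [Bool.and_eq_true, List.all_eq_true, List.mem_range, decide_eq_true_eq, qh_shV, shV_lev] at h
  have hi : tOf i = tOf (min i 5) ∧ (tabG L).get i = (tabG L).get (min i 5) := by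
    rcases Nat.lt_or_ge i 5 with h | h
    · rw [min_eq_left h.le]; exact ⟨rfl, rfl⟩
    · rw [min_eq_right h]
      obtain ⟨j, rfl⟩ := Nat.exists_eq_add_of_le h
      rw [Nat.add_comm]; exact ⟨rfl, rfl⟩
  rw [hi.1, hi.2]
  exact (h.1.2 (min i 5) (by omega)).trans (tabG_mono hL _)

/-- a tabled triple lies in `candTriples` -/
theorem mem_candTriples {L : ℕ} (hL : 28 ≤ L) (hL' : L ≤ 54) (h : x ∈ litLev L) : x ∈ candTriples := by
  unfold candTriples
  simp only [List.mem_append]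
  interval_cases L <;> simp [h]

/-- ratio levels are below `64` -/
theorem levT_lt (x : ℕ × ℕ × ℕ) : levT x < 64 := Nat.lt_succ_of_le (min_le_left _ _)

/-- **completeness of the candidate list**: every universe shape of order `M ≤ 337` with level `≥ 28` is listed -/
theorem shV_mem_candV (hM : M ≤ 337) (hx : InUniv M x) (h28 : 28 ≤ levT x) : shV M x ∈ candV M := by
  have h := allOK_of_inUniv (inUniv_mono hx hM)
  unfold allOK litOK at h
  simp only [Bool.and_eq_true, Bool.or_eq_true, decide_eq_true_eq, shV_lev, shV_tr] at h
  obtain ⟨h54, h' | h'⟩ := h.2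
  · omega
  · have hc := mem_candTriples h28 h54 h'
    unfold candV
    rw [List.mem_filterMap]
    refine ⟨x, hc, ?_⟩
    have hin : inUnivB M x.1 x.2.1 x.2.2 = true := hx
    rw [if_pos hin, Sh.force_eq]; rfl

/-- members of the candidate list come from tabled universe triples -/
theorem mem_candV {t : Sh} (ht : t ∈ candV M) : ∃ x ∈ candTriples, InUniv M x ∧ t = shV M x := by
  unfold candV at ht
  rw [List.mem_filterMap] at ht
  obtain ⟨x, hx, h⟩ := ht
  by_cases hin : inUnivB M x.1 x.2.1 x.2.2 = true
  · rw [if_pos hin, Sh.force_eq, Option.some.injEq] at h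
    exact ⟨x, hx, hin, by rw [← h]; rfl⟩
  · rw [if_neg hin] at h; exact absurd h (by simp)

/-- the candidate list is well formed -/
theorem candV_wf (M : ℕ) : WfV M (candV M) := by
  intro t ht; obtain ⟨x, -, -, rfl⟩ := mem_candV ht; rw [shV_tr]

/-- the candidate list lies inside the universe -/
theorem candV_inUniv (M : ℕ) : ∀ t ∈ candV M, InUniv M t.tr := by
  intro t ht; obtain ⟨x, -, hx, rfl⟩ := mem_candV ht; rwa [shV_tr]

/-- **the candidate list is in non-increasing ratio level** -/
theorem candV_sorted (M : ℕ) : (candV M).Pairwise (fun s t => t.lev ≤ s.lev) := by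
  haveI : IsTrans ℕ (fun a b => b ≤ a) := ⟨fun _ _ _ h1 h2 => h2.trans h1⟩
  have hp : (candTriples.map levT).Pairwise (fun a b => b ≤ a) :=
    List.isChain_iff_pairwise.mp candTriples_chain
  rw [List.pairwise_map] at hp
  unfold candV
  rw [List.pairwise_filterMap]
  refine hp.imp ?_
  intro x y hxy s hs t ht
  have es : s = shV M x := by
    by_cases hin : inUnivB M x.1 x.2.1 x.2.2 = true
    · rw [if_pos hin, Sh.force_eq, Option.some.injEq] at hs; rw [← hs]; rfl
    · rw [if_neg hin] at hs; exact absurd hs (by simp)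
  have et : t = shV M y := by
    by_cases hin : inUnivB M y.1 y.2.1 y.2.2 = true
    · rw [if_pos hin, Sh.force_eq, Option.some.injEq] at ht; rw [← ht]; rfl
    · rw [if_neg hin] at ht; exact absurd ht (by simp)
  rw [es, et, shV_lev, shV_lev]; exact hxy

end consequences

end Summit.MatrixMultiplication.MatrixMultiplication.Theorems.ShapeCertVP
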